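import Summits.HubbardSuperconductivity.HubbardSuperconductivity.Theorems.AnisotropyChordTransferFibre3N1RowJUFactorProofsA

/-!
# Route `AnisotropyChord` / H0 rotor rung: PORT PartN41-F — `N1RowJUFactor`, PROOFS (2/3): tails via Green, the slot factorisations (F), (Φ), the assembly `ObjectsNuSplit ⇒ N1RowJUFactor`

Port (verbatim; split into ≤ 400-line proof files per the tree lint) of §6 of the theory seat's file
`hubbard-h0-rotor-theory-1/cycle23/lean/PartN41F.lean` (sha16 `3f6ed68bc89a1b85`; theory-1 g23 RESULT 2, memo 23 §350):
theory's own proofs, rc 0, no sorry; statements in `…Fibre3N1RowJUFactor`.  Ported by prover seat `hubbard-h0-rotor-p1` g29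
(route lead); `--supports stmt-HubbardSuperconductivity-23918`.  WHAT THIS IS NOT: nothing here proves superconductivity in the
Hubbard model; identities of ONE row of ONE conditional reduction (piece A of the H0-rotor rung).
-/

set_option linter.dupNamespace false
set_option autoImplicit false

noncomputable section

open scoped BigOperators
open Complex Finset

namespace Summit.HubbardSuperconductivity.HubbardSuperconductivity.Theorems.AnisotropyChord.Transfer.Fibre3

namespace N41F

variable (L : ℕ) [NeZero L]

/-! ### The Green form of the tails and the two slot factorisations (F), (Φ) -/

/-- `FT[c₁g₁ + c₂g₂ + c₃]`. -/
theorem dft_combo (c1 c2 c3 : ℝ) (g1 g2 : Tor L → ℝ) (k : Tor L) :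
    dft L (fun r => c1 * g1 r + c2 * g2 r + c3) k
      = (c1 : ℂ) * dft L g1 k + (c2 : ℂ) * dft L g2 k + (c3 : ℂ) * ∑ r : Tor L, (starRingEnd ℂ) (phase L k r) := by
  unfold dft
  have h : ∀ r : Tor L, (starRingEnd ℂ) (phase L k r) * (((c1 * g1 r + c2 * g2 r + c3 : ℝ)) : ℂ)
      = (c1 : ℂ) * ((starRingEnd ℂ) (phase L k r) * (g1 r : ℂ)) + (c2 : ℂ) * ((starRingEnd ℂ) (phase L k r) * (g2 r : ℂ))
        + (c3 : ℂ) * (starRingEnd ℂ) (phase L k r) := by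
    intro r; push_cast; ring
  rw [Finset.sum_congr rfl (fun r _ => h r), Finset.sum_add_distrib, Finset.sum_add_distrib, ← Finset.mul_sum,
    ← Finset.mul_sum, ← Finset.mul_sum]

/-- `FT[c·g] = c·FT[g]`. -/
theorem dft_scale (c : ℝ) (g : Tor L → ℝ) (k : Tor L) :
    dft L (fun r => c * g r) k = (c : ℂ) * dft L g k := by
  have h := dft_combo L c 0 0 g g k
  simp only [zero_mul, add_zero, Complex.ofReal_zero] at h
  exact h

/-- `TailsViaGreen` holds. -/
theorem tailsViaGreen_holds (Δ : ℝ) : TailsViaGreen L Δ := by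
  intro lam2 f hL hΔ0 hΔ1 hf
  classical
  have hL0 : (0 : ℝ) < L := by exact_mod_cast (show 0 < L by omega)
  have hV : (0 : ℝ) < (L : ℝ) ^ 2 := by positivity
  have hV0 : (L : ℝ) ^ 2 ≠ 0 := hV.ne'
  have hs : ∀ r : Tor L, sfun' L Δ f r = cS L Δ lam2 f * Gres L lam2 r - aPar L Δ f / (L : ℝ) ^ 2 :=
    sfun'_eq_green L hL hΔ0 hΔ1 hf
  set c := cS L Δ lam2 f with hc
  set a := aPar L Δ f with ha
  -- s² = c²G̃² − (2a/V)s − a²/V²  (pointwise)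
  have hsq : ∀ r : Tor L, sfun' L Δ f r ^ 2
      = c ^ 2 * (Gres L lam2 r ^ 2) + (-(2 * a / (L : ℝ) ^ 2)) * sfun' L Δ f r + (-(a ^ 2 / ((L : ℝ) ^ 2) ^ 2)) := by
    intro r; rw [hs r]; ring
  have hl2 : lam2 < 2 * eps1 L := lam2_lt_two_eps1 L hL hΔ0 hf
  have hsh := dft_sfun' L (by omega) hf.1 hl2
  -- (2) t(k), k ≠ 0
  have h2 : ∀ k : Tor L, k ≠ 0 →
      tfun L Δ f k = c ^ 2 * T2fun L lam2 k - 2 * a / (L : ℝ) ^ 2 * c * gres L lam2 k := by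
    intro k hk
    unfold tfun T2fun
    rw [show (fun r => sfun' L Δ f r ^ 2)
        = (fun r => c ^ 2 * (Gres L lam2 r ^ 2) + (-(2 * a / (L : ℝ) ^ 2)) * sfun' L Δ f r + (-(a ^ 2 / ((L : ℝ) ^ 2) ^ 2)))
        from funext hsq, dft_combo, sum_conj_phase_right, if_neg hk, mul_zero, add_zero, hsh k, if_neg hk]
    have hg : gres L lam2 k = 1 / (2 * epsT L k - lam2) := by unfold gres; rw [if_neg hk]
    rw [hg, Complex.add_re, Complex.re_ofReal_mul, ← Complex.ofReal_mul, Complex.ofReal_re]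
    ring
  -- (3) ‖s‖²
  have hsum_s : ∑ r : Tor L, sfun' L Δ f r = -a := by
    have h := hsh 0
    rw [if_pos rfl, dft_zero] at h
    rw [ha]; unfold aPar; exact_mod_cast h
  have hT0 : T2fun L lam2 0 = ∑ r : Tor L, Gres L lam2 r ^ 2 := by
    unfold T2fun; rw [dft_zero]; exact_mod_cast rfl
  have h3 : sNormSq L Δ f = c ^ 2 * T2fun L lam2 0 + a ^ 2 / (L : ℝ) ^ 2 := by
    unfold sNormSq
    rw [Finset.sum_congr rfl (fun r _ => hsq r), Finset.sum_add_distrib, Finset.sum_add_distrib, ← Finset.mul_sum,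
      ← Finset.mul_sum, hsum_s, hT0, Finset.sum_const, Finset.card_univ, Fintype.card_prod, ZMod.card, nsmul_eq_mul]
    push_cast
    field_simp
    ring
  -- (4) τ_e = c² T_e
  have h4 : ∀ e ∈ nnList L, ∀ k : Tor L, tauC L Δ f e k = ((c ^ 2 : ℝ) : ℂ) * TeC L lam2 e k := by
    intro e _ k
    unfold tauC TeC
    have hD : ∀ r : Tor L, Dgrad L (sfun' L Δ f) e r ^ 2 = c ^ 2 * (Dgrad L (Gres L lam2) e r ^ 2) := by
      intro r; unfold Dgrad; rw [hs r, hs (r - e)]; ring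
    rw [show (fun r => Dgrad L (sfun' L Δ f) e r ^ 2) = (fun r => c ^ 2 * (Dgrad L (Gres L lam2) e r ^ 2))
        from funext hD, dft_scale]
  exact ⟨hs, h2, h3, h4⟩

/-- `F2NuSplit` holds. -/
theorem f2NuSplit_holds (Δ : ℝ) : F2NuSplit L Δ := by
  intro lam2 f hL hΔ0 hΔ1 hf k
  have hL0 : (0 : ℝ) < L := by exact_mod_cast (show 0 < L by omega)
  have hV : (0 : ℝ) < (L : ℝ) ^ 2 := by positivity
  have hV0 : (L : ℝ) ^ 2 ≠ 0 := hV.ne'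
  have hl : 0 < lam2 := lam2_pos L (by omega) hΔ1 hf.1
  obtain ⟨hF0, hFk⟩ := OuterMaj.f2ClosedPlusTail_holds L hL hΔ0 lam2 f hf hl
  obtain ⟨-, hc, -, -, -⟩ := dictionaryNu_holds L Δ lam2 f hL hΔ0 hΔ1 hf
  obtain ⟨-, ht, hn, -⟩ := tailsViaGreen_holds L Δ lam2 f hL hΔ0 hΔ1 hf
  by_cases hk : k = 0
  · subst hk
    rw [hF0]
    unfold nf2V jK FSr bPar
    rw [if_pos rfl, hn, hc]
    have hg0 : gres L lam2 (0 : Tor L) = 0 := by unfold gres; rw [if_pos rfl]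
    rw [hg0]
    field_simp
    ring
  · rw [hFk k hk, ht k hk]
    unfold cK jK FSr bPar dPar
    rw [if_neg hk, hc]
    unfold aPar
    field_simp
    ring

/-- `PhiHatNuSplit` holds. -/
theorem phiHatNuSplit_holds (Δ : ℝ) : PhiHatNuSplit L Δ := by
  intro lam2 f hL hΔ0 hΔ1 hf e he k
  have hL0 : (0 : ℝ) < L := by exact_mod_cast (show 0 < L by omega)
  have hV : (0 : ℝ) < (L : ℝ) ^ 2 := by positivity
  have hV0 : (L : ℝ) ^ 2 ≠ 0 := hV.ne'
  have hl : 0 < lam2 := lam2_pos L (by omega) hΔ1 hf.1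
  obtain ⟨hP0, hPk⟩ := OuterMaj.phiHatClosedPlusTail_holds L hL hΔ0 lam2 f hf hl e he
  obtain ⟨h1, hc, -, h3, -⟩ := dictionaryNu_holds L Δ lam2 f hL hΔ0 hΔ1 hf
  obtain ⟨-, ht, -, hτ⟩ := tailsViaGreen_holds L Δ lam2 f hL hΔ0 hΔ1 hf
  by_cases hk : k = 0
  · subst hk
    rw [hP0]
    unfold phiSr zPh
    rw [if_pos rfl, phase_zero_left, map_one, mul_one]
    unfold gamPar
    have key : lam2 * nf2V L Δ f / 4 + Δ * f (K1 L) ^ 2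
        = aPar L Δ f ^ 2 + lam2 * (aPar L Δ f * (L : ℝ) ^ 2 / 4 + nf2V L Δ f / 4) := by
      rw [h3]; ring
    rw [key]; push_cast; ring
  · rw [hPk k hk, ht k hk, hτ e he k]
    unfold phiSr muK betaK bPar
    rw [if_neg hk]
    -- the real scalar identities
    have hq : qPar L Δ f = aPar L Δ f ^ 2 + lam2 * (aPar L Δ f * (L : ℝ) ^ 2 / 2) := by
      have h1' := h1
      unfold aPar at h1'
      unfold qPar aPar
      linear_combination (2 * Δ * f (K1 L)) * h1'
    have hd : dPar L Δ f = aPar L Δ f ^ 2 := by unfold dPar aPar; ring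
    rw [hq, hd, hc]
    set a := aPar L Δ f
    set V := (L : ℝ) ^ 2
    set z := zPh L k e
    set g := gres L lam2 k
    set T := T2fun L lam2 k
    set U := TeC L lam2 e k
    have hVc : (V : ℂ) ≠ 0 := by exact_mod_cast hV0
    push_cast
    field_simp
    ring

/-! ### ★★ The assembly: `ObjectsNuSplit ⇒ N1RowJUFactor` (given `P > 0`, automatic for ground profiles) -/

/-- `‖Π⁰‖² > 0` on ground profiles (`ip_prodState_self_pos`, GroundState). -/
theorem piNormSq_pos_of_ground (hL : 2 ≤ L) {Δ lam2 : ℝ} {f : Tor L → ℝ} (hf : IsGroundTwoMagnon L Δ lam2 f) :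
    0 < PiNormSq L f := by
  rw [PiNormSq_eq_ip]
  exact ip_prodState_self_pos L hL hf

/-- `N1RowJUFactor` from the five object splits (S) (+ `N1Identity`, `G2OneLoopForm`, `sum_piR_C0fn`, `JUClosedSums`,
`DictionaryNu`, all proved): the `ν = 0` parts cancel symbolically. -/
theorem n1RowJUFactor_of_objects (Δ : ℝ) (hO : ObjectsNuSplit L Δ) :
    N1RowJUFactor L Δ := by
  intro lam2 f hL hΔ0 hΔ1 hf
  obtain ⟨-, hAs, hBs, hQs, hCs⟩ := hO lam2 f hL hΔ0 hΔ1 hf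
  have hP0 : 0 < PiNormSq L f := piNormSq_pos_of_ground L (by omega) hf
  have hQ := sum_piR_C0fn L hf.1
  have hN := n1Identity_holds L Δ lam2 f hf.1
  have hG := g2OneLoopForm_holds L (by omega) Δ lam2 f hf.1 hf.2.1 (fun r => ground_swap L (by omega) hf r)
  obtain ⟨-, -, hsig, h3, -⟩ := dictionaryNu_holds L Δ lam2 f hL hΔ0 hΔ1 hf
  obtain ⟨-, -, -, -, -, -, hσ2⟩ := juClosedSums_holds L Δ f (by omega)
  -- `T⁺ = λ₂(3 + X/P)`
  have hTP : (Tplus L Δ f - 3 * lam2) * PiNormSq L f = lam2 * (QJUr L Δ lam2 f + QSr L Δ lam2 f) := by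
    rw [← hQ, hQs]
  have hTd : Tplus L Δ f - 3 * lam2 = lam2 * (QJUr L Δ lam2 f + QSr L Δ lam2 f) / PiNormSq L f := by
    rw [eq_div_iff hP0.ne']; exact hTP
  have hT : Tplus L Δ f = lam2 * (3 + (QJUr L Δ lam2 f + QSr L Δ lam2 f) / PiNormSq L f) := by
    calc Tplus L Δ f = 3 * lam2 + (Tplus L Δ f - 3 * lam2) := by ring
      _ = 3 * lam2 + lam2 * (QJUr L Δ lam2 f + QSr L Δ lam2 f) / PiNormSq L f := by rw [hTd]
      _ = lam2 * (3 + (QJUr L Δ lam2 f + QSr L Δ lam2 f) / PiNormSq L f) := by ring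
  refine ⟨hT, ?_, ?_⟩
  · unfold Uunit Ured; rw [hT]; ring
  · rw [hN, hG, hT]
    unfold N1red N1JUlin
    have hPi : PiNormSq L f * (PiNormSq L f)⁻¹ = 1 := mul_inv_cancel₀ hP0.ne'
    rw [div_eq_mul_inv, div_eq_mul_inv]
    linear_combination (-(eps1 L)) * hBs
      + (-(eps1 L / 2 * lam2 * (QJUr L Δ lam2 f + QSr L Δ lam2 f))) * hPi
      + (-(6 * eps1 L * Axhat L f)) * h3 + (-(6 * eps1 L * aPar L Δ f ^ 2)) * hAs + hCs
      + (-(eps1 L)) * hσ2 + (-(6 * eps1 L * aPar L Δ f ^ 4 * (aPar L Δ f + bPar L Δ f))) * hsig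


end N41F

end Summit.HubbardSuperconductivity.HubbardSuperconductivity.Theorems.AnisotropyChord.Transfer.Fibre3

end
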